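import Literature.NumberTheory.LFunctions.FeketePolyaKernelPackedArithmetic
import Literature.NumberTheory.LFunctions.FeketePolyaKernelCertificatesResidueTables
import HarnessLib

/-!
# Packed sign tables of induced quadratic characters (engine v4 of the Fekete–Pólya lane)

Topic `Literature/NumberTheory/LFunctions`; namespace `Literature.NumberTheory.LFunctions.FeketePolyaKernel`
(sequel of `FeketePolyaKernelPackedArithmetic.lean` and `FeketePolyaKernelCertificatesResidueTables.lean`). Small
computable definitions and THEOREMS (no named fact, no `sorry`): the values of the induced character `χ↑(q·w)`
of a primitive quadratic `χ` of conductor `q` (`q` odd, `4m`, `8m`; `q` resp. `m` given by its list of prime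
factors) over ONE period `0 ≤ n < q·w`, as a pair `(P, M)` of PACKED 0/1 VECTORS (base `2^b`): digit `n` of `P` is
`1` iff the value is `+1`, digit `n` of `M` is `1` iff it is `−1` (`IsSignTab`). They are built with `O(#primes)`
big-integer operations from the quadratic-residue bitset `sqBits p (p − 1)` of each prime factor (spread to
digits, `qrPlus` / `qrMinus`; Euler's criterion is the ALREADY PROVED `legVal_eq`), periodic extension
(`pext`), digitwise products of sign tables (`mulTab`: two `&&&`, one `|||` per table), the patterns of `χ₋₄`,
`χ₋₈`, `χ₈`, and the mask `gcd(n, w) = 1` (`copBits`). Main results: `isSignTab_tabsOdd/Four/EightA/EightB` —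
the tables ARE the sign tables of `indVal (val…R (resTable ps)) (q·w)`, the value stream walked by the
certificates of `FeketePolyaKernelCertificates*.lean`.

## References

* H. L. Montgomery, R. C. Vaughan, *Multiplicative Number Theory I*, CUP 2007, §9.3 Thm 9.13, §11.2.1
  Exercises 7–8. [MontgomeryVaughan2007]
* J. von zur Gathen, J. Gerhard, *Modern Computer Algebra*, 3rd ed., CUP 2013, §8.4. [GathenGerhard2013ModernComputerAlgebra]
-/

namespace Literature.NumberTheory.LFunctions

namespace FeketePolyaKernel

open Finset Literature.Analysis.Convolution
open scoped NumberTheorySymbols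

/-! ### Sign tables -/

/-- The indicator digit of a proposition. [cite: GathenGerhard2013ModernComputerAlgebra, §8.4 (Kronecker substitution)] -/
def ind (P : Prop) [Decidable P] : ℕ := if P then 1 else 0

/-- `ind P ≤ 1`. [cite: GathenGerhard2013ModernComputerAlgebra, §8.4 (Kronecker substitution)] -/
theorem ind_le_one (P : Prop) [Decidable P] : ind P ≤ 1 := by
  unfold ind; split_ifs <;> omega

/-- `ind P < 2^b` for `b ≥ 1`. [cite: GathenGerhard2013ModernComputerAlgebra, §8.4 (Kronecker substitution)] -/
theorem ind_lt (P : Prop) [Decidable P] {b : ℕ} (hb : 1 ≤ b) : ind P < 2 ^ b :=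
  (ind_le_one P).trans_lt (Nat.one_lt_two_pow (by omega))

/-- `onesV` with its powers of two written as shifts, `((1 <<< bn) − 1)/((1 <<< b) − 1)`: the Lean kernel
evaluates `2 ^ N` natively only for `N < 2^24` but shifts of any size, and the period-length vectors below have
`b·N` up to `≈ 10⁸` bits. [cite: GathenGerhard2013ModernComputerAlgebra, §8.4 (Kronecker substitution)] -/
def onesS (b n : ℕ) : ℕ := ((1 <<< (b * n)) - 1) / ((1 <<< b) - 1)

/-- `onesS = onesV`. [cite: GathenGerhard2013ModernComputerAlgebra, §8.4 (Kronecker substitution)] -/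
theorem onesS_eq (b n : ℕ) : onesS b n = onesV b n := by
  unfold onesS onesV; rw [Nat.one_shiftLeft, Nat.one_shiftLeft]

/-- `pext` on `onesS`: periodic extension by one multiplication, shift form. [cite: GathenGerhard2013ModernComputerAlgebra, §8.4 (Kronecker substitution)] -/
def pextS (b L n T : ℕ) : ℕ := T * onesS (b * L) n

/-- `pextS = pext`. [cite: GathenGerhard2013ModernComputerAlgebra, §8.4 (Kronecker substitution)] -/
theorem pextS_eq (b L n T : ℕ) : pextS b L n T = pext b L n T := by
  unfold pextS pext; rw [onesS_eq]

/-- **Sign tables**: `PM = (P, M)` are the packed (base `2^b`) indicator vectors over the slots `n < N` of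
`y n = 1` and of `y n = −1`. [cite: GathenGerhard2013ModernComputerAlgebra, §8.4 (Kronecker substitution)] -/
def IsSignTab (b N : ℕ) (y : ℕ → ℤ) (PM : ℕ × ℕ) : Prop :=
  PM.1 = kpack b N (fun n => ind (y n = 1)) ∧ PM.2 = kpack b N (fun n => ind (y n = -1))

/-- Sign tables only see the values on the slots. [cite: GathenGerhard2013ModernComputerAlgebra, §8.4 (Kronecker substitution)] -/
theorem IsSignTab.congr {b N : ℕ} {y y' : ℕ → ℤ} {PM : ℕ × ℕ} (h : IsSignTab b N y PM)
    (hy : ∀ n < N, y n = y' n) : IsSignTab b N y' PM :=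
  ⟨h.1.trans (kpack_congr fun n hn => by rw [hy n hn]), h.2.trans (kpack_congr fun n hn => by rw [hy n hn])⟩

/-- A value in `{0, 1, −1}`. [cite: MontgomeryVaughan2007, §9.3 Theorem 9.13] -/
def Val3 (z : ℤ) : Prop := z = 0 ∨ z = 1 ∨ z = -1

/-- **Digitwise product of sign tables**: `((P &&& EP) ||| (M &&& EM), (P &&& EM) ||| (M &&& EP))`.
[cite: GathenGerhard2013ModernComputerAlgebra, §8.4 (Kronecker substitution)] -/
def mulTab (P M EP EM : ℕ) : ℕ × ℕ := ((P &&& EP) ||| (M &&& EM), (P &&& EM) ||| (M &&& EP))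

/-- `mulTab` multiplies the represented `{0, ±1}`-valued functions. [cite: MontgomeryVaughan2007, §9.3 Theorem 9.13] -/
theorem isSignTab_mulTab {b N : ℕ} (hb : 1 ≤ b) {y e : ℕ → ℤ} {P M EP EM : ℕ}
    (hy : IsSignTab b N y (P, M)) (he : IsSignTab b N e (EP, EM)) (hy3 : ∀ n, Val3 (y n))
    (he3 : ∀ n, Val3 (e n)) : IsSignTab b N (fun n => y n * e n) (mulTab P M EP EM) := by
  obtain ⟨h1, h2⟩ := hy
  obtain ⟨h3, h4⟩ := he
  simp only at h1 h2 h3 h4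
  subst h1 h2 h3 h4
  have hl : ∀ (Q : ℕ → Prop) [DecidablePred Q], ∀ j < N, (fun n => ind (Q n)) j < 2 ^ b :=
    fun Q _ j _ => ind_lt _ hb
  have hll : ∀ (Q Q' : ℕ → Prop) [DecidablePred Q] [DecidablePred Q'],
      ∀ j < N, (fun n => ind (Q n) &&& ind (Q' n)) j < 2 ^ b :=
    fun Q Q' _ _ j hj => Nat.and_lt_two_pow _ (ind_lt _ hb)
  unfold mulTab IsSignTab
  simp only
  rw [kpack_land hb (hl _) (hl _), kpack_land hb (hl _) (hl _), kpack_land hb (hl _) (hl _),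
    kpack_land hb (hl _) (hl _), kpack_lor hb (hll _ _) (hll _ _), kpack_lor hb (hll _ _) (hll _ _)]
  constructor
  · refine kpack_congr fun n _ => ?_
    rcases hy3 n with h | h | h <;> rcases he3 n with h' | h' | h' <;> simp [h, h', ind]
  · refine kpack_congr fun n _ => ?_
    rcases hy3 n with h | h | h <;> rcases he3 n with h' | h' | h' <;> simp [h, h', ind]

/-- **Periodic extension of sign tables**: `L`-periodic values, `L ∣ N`. [cite: MontgomeryVaughan2007, §11.2.1 Exercise 8] -/
theorem isSignTab_pext {b L N : ℕ} (hb : 1 ≤ b) (hL : 1 ≤ L) (hLN : L ∣ N) {y : ℕ → ℤ} {P M : ℕ}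
    (h : IsSignTab b L y (P, M)) (hper : ∀ s, y (s % L) = y s) :
    IsSignTab b N y (pextS b L (N / L) P, pextS b L (N / L) M) := by
  obtain ⟨h1, h2⟩ := h
  simp only at h1 h2
  subst h1 h2
  have hN : L * (N / L) = N := Nat.mul_div_cancel' hLN
  refine ⟨?_, ?_⟩ <;> simp only [pextS_eq, pext_kpack hb hL, hN, hper]

/-! ### Quadratic-residue tables of a prime, spread to digits -/

/-- Digits `1 ≤ r < p` that are squares mod `p`: the bitset `sqBits p (p − 1)` spread to base-`2^b` digits
(chunks of `b − 1` bits), digit `0` and digits `≥ p` cleared. [cite: MontgomeryVaughan2007, §9.3] -/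
def qrPlus (b p : ℕ) : ℕ :=
  spreadBits b (b - 1) (sqBits p (p - 1)) ((p + (b - 1) - 1) / (b - 1) + 1) &&& (onesS b p - 1)

/-- Digits `1 ≤ r < p` that are NOT squares mod `p`. [cite: MontgomeryVaughan2007, §9.3] -/
def qrMinus (b p : ℕ) : ℕ := (onesS b p - 1) - qrPlus b p

/-- `Nat.beq j 0 = false` for `j ≠ 0`. [folklore] -/
private theorem beq_false_of_ne {j : ℕ} (h : j ≠ 0) : Nat.beq j 0 = false := by
  cases hj : Nat.beq j 0
  · rfl
  · exact absurd (Nat.eq_of_beq_eq_true hj) h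

/-- `onesV b p − 1 = kpack b p (r ↦ [r ≠ 0])` (`p ≥ 1`). [folklore] -/
private theorem onesV_sub_one {b p : ℕ} (hb : 1 ≤ b) (hp : 1 ≤ p) :
    onesV b p - 1 = kpack b p fun r => ind (r ≠ 0) := by
  have h1 : (kpack b p fun r => ind (r = 0)) = 1 := by
    obtain ⟨p', rfl⟩ : ∃ p', p = 1 + p' := ⟨p - 1, by omega⟩
    rw [kpack_extend (d := fun r => ind (r = 0)) (fun j _ => rfl) (fun j hj _ => by simp [ind]; omega)]
    simp [ind]
  have h2 : (kpack b p fun r => ind (r = 0)) + (kpack b p fun r => ind (r ≠ 0)) = kpack b p fun _ => 1 := by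
    rw [kpack_add_kpack]
    exact kpack_congr fun j _ => by by_cases h : j = 0 <;> simp [ind, h]
  rw [onesV_eq_kpack hb]
  omega

/-- **The residue tables are the sign tables of `legVal`** (`b ≥ 2`, `p ≥ 1`): digit `r` of `qrPlus b p` is
`[legVal p B r = 1]`, of `qrMinus b p` is `[legVal p B r = −1]`, `B = sqBits p (p − 1)` — by the very definition of
`legVal` (bit `r` of `B`, and `0` at `r = 0`); with `legVal_eq` these are `[(r/p) = ±1]` for a prime `p`.
[cite: MontgomeryVaughan2007, §9.3] -/
theorem isSignTab_qr {b p : ℕ} (hb : 2 ≤ b) (hp : 1 ≤ p) :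
    IsSignTab b p (fun n => legVal p (sqBits p (p - 1)) n) (qrPlus b p, qrMinus b p) := by
  set B := sqBits p (p - 1) with hB
  set I := (p + (b - 1) - 1) / (b - 1) + 1 with hI
  have hb1 : 1 ≤ b := by omega
  have hpI : p ≤ (b - 1) * I := by
    have h1 : 1 ≤ b - 1 := by omega
    have := Nat.lt_div_mul_add (a := p + (b - 1) - 1) h1
    rw [hI, Nat.mul_add, Nat.mul_one, Nat.mul_comm]
    omega
  -- the spread bitset as a vector of `p` digits extended by zeros (digits ≥ p are masked anyway)
  have hspread := spreadBits_eq (A := B) hb le_rfl I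
  -- the mask, extended by zero digits to the length of the spread vector
  obtain ⟨r, hr⟩ : ∃ r, (b - 1) * I = p + r := ⟨(b - 1) * I - p, by omega⟩
  have hmask : onesV b p - 1 = kpack b ((b - 1) * I) fun j => if j < p then ind (j ≠ 0) else 0 := by
    rw [onesV_sub_one hb1 hp, hr]
    exact (kpack_extend (fun j hj => by simp [hj]) (fun j hj _ => by simp [not_lt.2 hj])).symm
  have hbit : ∀ j < (b - 1) * I, (fun r => (B.testBit r).toNat) j < 2 ^ b := fun j _ =>
    (Bool.toNat_le _).trans_lt (Nat.one_lt_two_pow (by omega))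
  have hmk : ∀ j < (b - 1) * I, (fun j => if j < p then ind (j ≠ 0) else 0) j < 2 ^ b := fun j _ => by
    dsimp only
    split_ifs
    · exact ind_lt _ hb1
    · positivity
  have hplus : qrPlus b p = kpack b p fun n => ind (legVal p B n = 1) := by
    rw [qrPlus, onesS_eq, ← hB, hspread, hmask, kpack_land (by omega) hbit hmk, hr]
    refine kpack_extend (fun j hj => ?_) (fun j hj _ => by simp [not_lt.2 hj])
    simp only [if_pos hj, legVal, Nat.mod_eq_of_lt hj]
    by_cases hj0 : j = 0
    · simp [hj0, ind]
    · have : Nat.beq j 0 = false := beq_false_of_ne hj0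
      cases hBj : B.testBit j <;> simp [this, ind, hj0]
  refine ⟨hplus, ?_⟩
  show qrMinus b p = _
  rw [qrMinus, onesS_eq, hplus, onesV_sub_one hb1 hp, kpack_tsub fun j _ => ?_]
  · refine kpack_congr fun j hj => ?_
    simp only [legVal, Nat.mod_eq_of_lt hj]
    by_cases hj0 : j = 0
    · simp [hj0, ind]
    · have : Nat.beq j 0 = false := beq_false_of_ne hj0
      cases hBj : B.testBit j <;> simp [this, ind, hj0]
  · by_cases hj0 : j = 0
    · subst hj0; simp [ind, legVal]
    · simp only [ind, if_pos hj0]; split_ifs <;> omega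

/-! ### Jacobi tables of a factor list, twists, the coprimality mask -/

/-- Sign tables of `n ↦ jacVal (resTable ps) n` over `Q` slots (every `p ∈ ps` divides `Q`): all-plus start,
one `mulTab` with the extended residue tables per prime factor. [cite: MontgomeryVaughan2007, §9.3 Theorem 9.13] -/
def jacTabs (b Q : ℕ) : List ℕ → ℕ × ℕ
  | [] => (onesS b Q, 0)
  | p :: rest =>
    match jacTabs b Q rest with
    | (P, M) => mulTab P M (pextS b p (Q / p) (qrPlus b p)) (pextS b p (Q / p) (qrMinus b p))

/-- `legVal` takes values in `{0, 1, −1}`. [cite: MontgomeryVaughan2007, §9.3 Theorem 9.13] -/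
theorem val3_legVal (p B n : ℕ) : Val3 (legVal p B n) := by
  unfold legVal Val3
  cases Nat.beq (n % p) 0 <;> cases B.testBit (n % p) <;> simp

/-- `jacVal` takes values in `{0, 1, −1}`. [cite: MontgomeryVaughan2007, §9.3 Theorem 9.13] -/
theorem val3_jacVal : ∀ (tbl : List (ℕ × ℕ)) (n : ℕ), Val3 (jacVal tbl n)
  | [], n => by simp [jacVal, Val3]
  | (p, B) :: rest, n => by
    have h1 := val3_legVal p B n
    have h2 := val3_jacVal rest n
    unfold Val3 at h1 h2 ⊢
    rw [jacVal]
    rcases h1 with h | h | h <;> rcases h2 with h' | h' | h' <;> simp [h, h']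

/-- **`jacTabs` are the sign tables of `jacVal (resTable ps)`** over `Q` slots (`b ≥ 2`; every `p ∈ ps` is
`≥ 1` and divides `Q`). [cite: MontgomeryVaughan2007, §9.3 Theorem 9.13] -/
theorem isSignTab_jacTabs {b Q : ℕ} (hb : 2 ≤ b) :
    ∀ ps : List ℕ, (∀ p ∈ ps, 1 ≤ p ∧ p ∣ Q) → IsSignTab b Q (fun n => jacVal (resTable ps) n) (jacTabs b Q ps)
  | [], _ => by
    refine ⟨?_, ?_⟩
    · show onesS b Q = _
      rw [onesS_eq, onesV_eq_kpack (by omega)]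
      exact kpack_congr fun n _ => by simp [resTable, jacVal, ind]
    · show (0 : ℕ) = _
      rw [← kpack_zero_fun b Q]
      exact kpack_congr fun n _ => by simp [resTable, jacVal, ind]
  | p :: rest, hps => by
    have hp := hps p (by simp)
    have ih := isSignTab_jacTabs hb rest fun p' hp' => hps p' (by simp [hp'])
    have hq := isSignTab_pext (N := Q) (by omega) hp.1 hp.2 (isSignTab_qr hb hp.1)
      (fun s => by simp only [legVal, Nat.mod_mod])
    rw [jacTabs]
    split
    next P M hPM =>
      rw [hPM] at ih
      refine (isSignTab_mulTab (by omega) ih hq (val3_jacVal _) (val3_legVal _ _)).congr fun n _ => ?_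
      show jacVal (resTable rest) n * legVal p (sqBits p (p - 1)) n =
        jacVal ((p, sqBits p (p - 1)) :: resTable rest) n
      rw [jacVal, mul_comm]

/-- Twist of sign tables over `Q` slots by a pattern of period `L` given by its sign tables `(pp, pm)` over `L`
slots. [cite: MontgomeryVaughan2007, §9.3 Theorem 9.13] -/
def twistTabs (b Q L pp pm : ℕ) (PM : ℕ × ℕ) : ℕ × ℕ :=
  match PM with
  | (P, M) => mulTab P M (pextS b L (Q / L) pp) (pextS b L (Q / L) pm)

/-- `Σ_{t<r, gcd(t,w)=1} 2^{bt}`. [cite: MontgomeryVaughan2007, §11.2.1 Exercise 8] -/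
def copBits (b w : ℕ) : ℕ → ℕ
  | 0 => 0
  | r + 1 => copBits b w r + (if Nat.gcd r w = 1 then 1 <<< (b * r) else 0)

/-- `copBits b w r = kpack b r [gcd(·, w) = 1]`. [cite: MontgomeryVaughan2007, §11.2.1 Exercise 8] -/
theorem copBits_eq (b w : ℕ) : ∀ r, copBits b w r = kpack b r fun t => ind (Nat.gcd t w = 1)
  | 0 => by simp [copBits]
  | r + 1 => by
    rw [copBits, copBits_eq b w r, kpack_succ]
    congr 1
    unfold ind
    split_ifs <;> simp [Nat.shiftLeft_eq]

/-- Restriction of sign tables over `Q` slots to `gcd(n, w) = 1` (`w ∣ Q`). [cite: MontgomeryVaughan2007, §11.2.1 Exercise 8] -/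
def maskTabs (b Q w : ℕ) (PM : ℕ × ℕ) : ℕ × ℕ :=
  match PM with
  | (P, M) =>
    let C := pextS b w (Q / w) (copBits b w w)
    (P &&& C, M &&& C)

/-- `maskTabs` restricts the represented function to `gcd(n, w) = 1`. [cite: MontgomeryVaughan2007, §11.2.1 Exercise 8] -/
theorem isSignTab_maskTabs {b Q w : ℕ} (hb : 1 ≤ b) (hw : 1 ≤ w) (hwQ : w ∣ Q) {y : ℕ → ℤ} {PM : ℕ × ℕ}
    (h : IsSignTab b Q y PM) :
    IsSignTab b Q (fun n => if Nat.gcd n w = 1 then y n else 0) (maskTabs b Q w PM) := by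
  obtain ⟨P, M⟩ := PM
  obtain ⟨h1, h2⟩ := h
  simp only at h1 h2
  subst h1 h2
  have hC : pextS b w (Q / w) (copBits b w w) = kpack b Q fun n => ind (Nat.gcd n w = 1) := by
    rw [pextS_eq, copBits_eq, pext_kpack hb hw, Nat.mul_div_cancel' hwQ]
    exact kpack_congr fun n _ => by
      have hgcd : (n % w).gcd w = n.gcd w := by rw [← Nat.gcd_rec, Nat.gcd_comm]
      unfold ind
      by_cases h1 : n.gcd w = 1
      · rw [if_pos h1, if_pos (by rw [hgcd]; exact h1)]
      · rw [if_neg h1, if_neg (by rw [hgcd]; exact h1)]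
  have hl : ∀ (R : ℕ → Prop) [DecidablePred R], ∀ j < Q, (fun n => ind (R n)) j < 2 ^ b :=
    fun R _ j _ => ind_lt _ hb
  unfold maskTabs IsSignTab
  simp only [hC]
  rw [kpack_land hb (hl _) (hl _), kpack_land hb (hl _) (hl _)]
  constructor
  · refine kpack_congr fun n _ => ?_
    by_cases hg : Nat.gcd n w = 1 <;> by_cases hy : y n = 1 <;> simp [hg, hy, ind]
  · refine kpack_congr fun n _ => ?_
    by_cases hg : Nat.gcd n w = 1 <;> by_cases hy : y n = -1 <;> simp [hg, hy, ind]

end FeketePolyaKernel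

end Literature.NumberTheory.LFunctions
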